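import Literature.NumberTheory.Rogawski1990.LocalTransfer
import HarnessLib

/-!
# Rescaling a transfer factor by a constant: `(c • Δ)(γ_H, γ) := c · Δ(γ_H, γ)` — the sign plumbing `Δ‴_v = ε_v(H) · Δ_v^{print}`
(Rogawski, *Automorphic Representations of Unitary Groups in Three Variables* (1990), §4.3 p. 43, §4.9 p. 55, §14.6 p. 242;
Langlands–Shelstad (1987), §1)

Topic `NumberTheory/Rogawski1990`; namespace `Literature.NumberTheory.Rogawski1990`.  ONE DEFINITION WITH BODY + its `rfl` unfolding; no named fact
(net debt 0), no instance, no notation, no attribute removal, no `sorry`.  This file ASSERTS NOTHING.  Cell `pub/hodgecm-mathlib` (D-0151), crux H413 =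
`stmt-HodgeConjecture-24833`; organ B1 «SIGN-RESCALE» of referee F0P2-ref1 (g10) objection ⑧ r353 (the Day-X D7αᵀ recipe needs the UNSIGNED letters at print's
factor `Δ°_v := ε_v(H) · Δ‴_v` from the closer's SIGNED exports at the factor of record `Δ‴_v`); seat F0P2-p06 (g14).

WHY.  ★ `TransferFactorData` [§4.3 p. 43] records a transfer factor `Δ(γ_H, γ)` AS DATA: a function vanishing off the matching relation and a class function in
each variable.  All three axioms are invariant under multiplication by a constant `c ∈ ℂ`, so `c · Δ` is again a transfer factor for the SAME relation.  Print's
factor `Δ_v` of [§4.9 p. 55] and the tree's factor of record `Δ‴_v` (★ `finExplicitCollection`) differ on an inner form by the sign `ε_v(H) = ω_{L_w∕L⁺_v}(−det H)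
∈ {±1}` (★ `FinExplicitTransferFactorLeviStratumFrame`, «κ-SIGN»; the product formula holds for print's factor only up to `c = ±1` [§14.6 p. 242]); `Δ.constMul ε`
is the plumbing that moves this sign between the factor and the member traces of the character identity (13.1.4) (★ `CharIdentityOnTestFunctionsSigned`), see
the sibling theorems-only module `CharIdentityOnTestFunctionsSignTransport`.
* **`TransferFactorData.constMul T c`** — `Δ := fun γ_H γ => c * T.Δ γ_H γ`; `constMul_Δ` (`rfl`).  The algebra (`constMul_one`, `constMul_constMul`, extensionality in `Δ`)
  is in the theorems-only sibling `CharIdentityOnTestFunctionsSignTransport` §0.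
HONEST SCOPE.  A definition and its unfolding; HC_CM is proved only modulo the printed citations (2 remaining named inputs hLiu418, h413) until
rung 0 closes; this file proves no printed statement.

## References
* [Rogawski1990] J. D. Rogawski, *Automorphic Representations of Unitary Groups in Three Variables*, Ann. of Math. Studies 123 (1990): §4.3 p. 43 (transfer
  factors, (4.3.1)–(4.3.2)), §4.9 p. 55 (the local factor), §14.6 p. 242 (product formula up to a sign).
* [LanglandsShelstad1987] R. P. Langlands, D. Shelstad, *On the definition of transfer factors*, Math. Ann. 278 (1987): §1.
-/

noncomputable section

namespace Literature.NumberTheory.Rogawski1990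

variable {A B : Type*} [Group A] [Group B] {R : A → B → Prop}

/-- **The rescaled transfer factor `(c • Δ)(γ_H, γ) := c · Δ(γ_H, γ)`** for a constant `c ∈ ℂ`: it vanishes off the matching relation and is a class function in
each variable because `Δ` is.  Used with `c = ε_v(H) ∈ {±1}` to pass between the tree's factor of record `Δ‴_v` and print's `Δ_v = ε_v(H) · Δ‴_v` on an inner form.
[cite: Rogawski1990, §4.3 p. 43; §14.6 p. 242] [cite: LanglandsShelstad1987, §1] -/
def TransferFactorData.constMul (T : TransferFactorData A B R) (c : ℂ) : TransferFactorData A B R :=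
  { Δ := fun a b => c * T.Δ a b
    eq_zero_of_not_rel := fun a b hn => (congrArg (fun z : ℂ => c * z) (T.eq_zero_of_not_rel a b hn)).trans (mul_zero c)
    conj_left := fun a b x => congrArg (fun z : ℂ => c * z) (T.conj_left a b x)
    conj_right := fun a b y => congrArg (fun z : ℂ => c * z) (T.conj_right a b y) }

/-- `(Δ.constMul c)(γ_H, γ) = c · Δ(γ_H, γ)` (definitional). [cite: Rogawski1990, §4.3 p. 43] -/
theorem TransferFactorData.constMul_Δ (T : TransferFactorData A B R) (c : ℂ) (a : A) (b : B) :
    (T.constMul c).Δ a b = c * T.Δ a b :=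
  rfl

end Literature.NumberTheory.Rogawski1990

end
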